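import Literature.Analysis.PDE.LoewnerNirenbergFacts
import Mathlib.Analysis.Calculus.LocalExtr.Basic
import HarnessLib

/-!
# The weak parabolic maximum principle, pointwise-`C²` form

Analysis/FluidPDE proof file (no definitions, no named facts, no `sorry`). The tree's abstract
weak parabolic maximum principle `Literature.Analysis.FluidPDE.weak_max_principle`
(`SwirlMaximumPrinciple.lean`; Lieberman 1996, Ch. II, Lemma 2.1 with Lemma 2.3) asks the
comparison function `w` to have GLOBALLY `C²` slices. Comparison functions built from the distance
to a point (here: the swirl barrier `K Ψ(|x − c|/√(T − t)) + A|x − c|²/(T − t)` of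
`SwirlTypeIBarrier.lean`, singular at its centre `c` on the axis) are `C²` only off that point,
which lies OUTSIDE the open set `U` where the differential inequality is used. This file records
the principle with the slice regularity asked only pointwise on `U`:

* `weak_max_principle_of_contDiffAt` — `K` compact, `U ⊆ K` open, `w` jointly continuous on
  `[T₁, T₂] × K`, `ContDiffAt ℝ 2 (w t) x` and a left time derivative `wₜ t x` at the points of
  `(T₁, T₂] × U`, the sub-solution implication `∇w = 0 → Δw ≤ 0 → wₜ ≤ 0` there, `w ≤ 0` on the
  parabolic boundary `({T₁} × K) ∪ ([T₁, T₂] × (K ∖ U))` ⟹ `w ≤ 0` on `[T₁, T₂] × K`.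

The proof is that of `weak_max_principle` verbatim (a positive value forces a positive maximum of
`w − θ(t − T₁)` off the parabolic boundary, where `∇w = 0`, `Δw ≤ 0`, `wₜ ≥ θ > 0`), the
second-order condition at the maximum being the pointwise
`Literature.Analysis.PDE.LoewnerNirenberg.laplacian_nonpos_of_isLocalMax` (`ContDiffAt ℝ 2`)
instead of `IsLocalMax.laplacian_nonpos` (`ContDiff ℝ 2`).

## References

* G. M. Lieberman, *Second order parabolic differential equations*, World Scientific 1996,
  Ch. II, Lemma 2.1, Lemma 2.3. [`Lieberman1996`]
-/

noncomputable section

open MeasureTheory Set Function Filter Topology Metric InnerProductSpace WithLp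
open scoped RealInnerProductSpace Laplacian ContDiff NNReal

namespace Literature.Analysis.FluidPDE

/-! ### The weak parabolic maximum principle, pointwise-`C²` form -/

section WeakMax

variable {E : Type*} [NormedAddCommGroup E] [InnerProductSpace ℝ E] [FiniteDimensional ℝ E]

/-- **Weak parabolic maximum principle, pointwise-`C²` form** (Lieberman 1996, Ch. II,
Lemma 2.1 with Lemma 2.3): the tree's `weak_max_principle` with the slice regularity asked only
AT THE POINTS OF `U` (`ContDiffAt ℝ 2 (w t) x` for `x ∈ U`), which is what a comparison function
that is singular at points of `K ∖ U` (here: an axis point) provides. `K` compact, `U ⊆ K` open,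
`w` jointly continuous on `[T₁, T₂] × K` with a left time derivative `wₜ` on `(T₁, T₂] × U`, the
sub-solution implication `∇w = 0 → Δw ≤ 0 → wₜ ≤ 0` there, and `w ≤ 0` on the parabolic boundary;
then `w ≤ 0` on `[T₁, T₂] × K`. Proof verbatim as `weak_max_principle`, the second-order
condition at the interior maximum taken from the pointwise
`LoewnerNirenberg.laplacian_nonpos_of_isLocalMax`.
[cite: Lieberman1996, Ch. II Lemma 2.1 and Lemma 2.3] -/
theorem weak_max_principle_of_contDiffAt {K U : Set E} (hK : IsCompact K) (hU : IsOpen U)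
    (hUK : U ⊆ K) {T₁ T₂ : ℝ} {w wₜ : ℝ → E → ℝ}
    (hc : ContinuousOn (uncurry w) (Icc T₁ T₂ ×ˢ K))
    (h2 : ∀ t ∈ Ioc T₁ T₂, ∀ x ∈ U, ContDiffAt ℝ 2 (w t) x)
    (ht : ∀ t ∈ Ioc T₁ T₂, ∀ x ∈ U, HasDerivWithinAt (fun s => w s x) (wₜ t x) (Icc T₁ t) t)
    (hsub : ∀ t ∈ Ioc T₁ T₂, ∀ x ∈ U, fderiv ℝ (w t) x = 0 → (Δ (w t)) x ≤ 0 → wₜ t x ≤ 0)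
    (hbot : ∀ x ∈ K, w T₁ x ≤ 0)
    (hlat : ∀ t ∈ Icc T₁ T₂, ∀ x ∈ K \ U, w t x ≤ 0) :
    ∀ t ∈ Icc T₁ T₂, ∀ x ∈ K, w t x ≤ 0 := by
  by_contra H
  push Not at H
  obtain ⟨t₀, ht₀, x₀, hx₀, hpos⟩ := H
  set δ : ℝ := w t₀ x₀ with hδ
  set θ : ℝ := δ / (2 * (T₂ - T₁ + 1)) with hθ
  have hT : T₁ ≤ T₂ := ht₀.1.trans ht₀.2
  have hθpos : 0 < θ := div_pos hpos (by linarith)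
  have hθδ : θ * (t₀ - T₁) < δ := by
    have h1 : θ * (t₀ - T₁) ≤ θ * (T₂ - T₁ + 1) :=
      mul_le_mul_of_nonneg_left (by linarith [ht₀.2]) hθpos.le
    have h2 : θ * (T₂ - T₁ + 1) = δ / 2 := by
      rw [hθ, div_mul_eq_mul_div, mul_div_mul_right _ _ (by linarith : (T₂ - T₁ + 1) ≠ 0)]
    linarith
  set S : Set (ℝ × E) := Icc T₁ T₂ ×ˢ K with hS
  have hSc : IsCompact S := isCompact_Icc.prod hK
  set g : ℝ × E → ℝ := fun p => w p.1 p.2 - θ * (p.1 - T₁) with hg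
  have hgc : ContinuousOn g S := by
    have h3 : Continuous fun p : ℝ × E => θ * (p.1 - T₁) := by fun_prop
    exact hc.sub h3.continuousOn
  obtain ⟨⟨t', x'⟩, ⟨ht', hx'⟩, hmax⟩ := hSc.exists_isMaxOn ⟨(t₀, x₀), ht₀, hx₀⟩ hgc
  simp only at ht' hx'
  have hmax' : ∀ t ∈ Icc T₁ T₂, ∀ x ∈ K, w t x - θ * (t - T₁) ≤ w t' x' - θ * (t' - T₁) :=
    fun t ht x hx => hmax (show (t, x) ∈ S from ⟨ht, hx⟩)
  have hgpos : 0 < w t' x' - θ * (t' - T₁) := by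
    have := hmax' t₀ ht₀ x₀ hx₀
    linarith
  have hwpos : 0 < w t' x' := by
    have : 0 ≤ θ * (t' - T₁) := mul_nonneg hθpos.le (by linarith [ht'.1])
    linarith
  have ht'1 : T₁ < t' := by
    rcases eq_or_lt_of_le ht'.1 with h | h
    · exfalso
      have hb := hbot x' hx'
      rw [h] at hb
      linarith
    · exact h
  have hx'U : x' ∈ U := by
    by_contra hxU
    have hl := hlat t' ht' x' ⟨hx', hxU⟩
    linarith
  have ht'I : t' ∈ Ioc T₁ T₂ := ⟨ht'1, ht'.2⟩
  have hloc : IsLocalMax (w t') x' := by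
    filter_upwards [hU.mem_nhds hx'U] with x hx
    have := hmax' t' ht' x (hUK hx)
    linarith
  have hgrad : fderiv ℝ (w t') x' = 0 := hloc.fderiv_eq_zero
  have hlap : (Δ (w t')) x' ≤ 0 :=
    Literature.Analysis.PDE.LoewnerNirenberg.laplacian_nonpos_of_isLocalMax hloc (h2 t' ht'I x' hx'U)
  have hwt : wₜ t' x' ≤ 0 := hsub t' ht'I x' hx'U hgrad hlap
  have hderiv : HasDerivWithinAt (fun s => w s x' - θ * (s - T₁)) (wₜ t' x' - θ) (Icc T₁ t') t' := by
    have h1 := ht t' ht'I x' hx'U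
    have h2 : HasDerivWithinAt (fun s : ℝ => θ * (s - T₁)) θ (Icc T₁ t') t' := by
      have := ((hasDerivAt_id t').sub_const T₁).const_mul θ
      simpa using this.hasDerivWithinAt
    exact h1.sub h2
  have hmaxOn : IsLocalMaxOn (fun s => w s x' - θ * (s - T₁)) (Icc T₁ t') t' :=
    Filter.eventually_of_mem self_mem_nhdsWithin fun s hs =>
      hmax' s ⟨hs.1, hs.2.trans ht'.2⟩ x' hx'
  have hcone : T₁ - t' ∈ posTangentConeAt (Icc T₁ t') t' := by
    have hseg : segment ℝ t' T₁ ⊆ Icc T₁ t' := by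
      rw [segment_symm, segment_eq_Icc ht'1.le]
    exact sub_mem_posTangentConeAt_of_segment_subset hseg
  have key : (T₁ - t') * (wₜ t' x' - θ) ≤ 0 := by
    simpa using hmaxOn.hasFDerivWithinAt_nonpos hderiv.hasFDerivWithinAt hcone
  have hneg : T₁ - t' < 0 := by linarith
  have : 0 ≤ wₜ t' x' - θ := by
    by_contra hcon
    push Not at hcon
    have := mul_pos_of_neg_of_neg hneg hcon
    linarith
  linarith


/-- **Weak parabolic maximum principle, pointwise-`C²` form, sub-solution property asked only on
the positivity set.** As `weak_max_principle_of_contDiffAt`, but the implication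
`∇w = 0 → Δw ≤ 0 → wₜ ≤ 0` is required only at points `(t, x) ∈ (T₁, T₂] × U` where `0 < w t x`:
the proof of Lieberman's Lemma 2.1 evaluates it only at a point of POSITIVE maximum of
`w − θ(t − T₁)`. (Useful when the differential inequality for `w` is available only where `w`
exceeds its parabolic boundary values, e.g. a source term with a sign only on `{w > 0}`.)
[cite: Lieberman1996, Ch. II Lemma 2.1 and Lemma 2.3] -/
theorem weak_max_principle_of_contDiffAt_of_pos {K U : Set E} (hK : IsCompact K) (hU : IsOpen U)
    (hUK : U ⊆ K) {T₁ T₂ : ℝ} {w wₜ : ℝ → E → ℝ}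
    (hc : ContinuousOn (uncurry w) (Icc T₁ T₂ ×ˢ K))
    (h2 : ∀ t ∈ Ioc T₁ T₂, ∀ x ∈ U, ContDiffAt ℝ 2 (w t) x)
    (ht : ∀ t ∈ Ioc T₁ T₂, ∀ x ∈ U, HasDerivWithinAt (fun s => w s x) (wₜ t x) (Icc T₁ t) t)
    (hsub : ∀ t ∈ Ioc T₁ T₂, ∀ x ∈ U, 0 < w t x → fderiv ℝ (w t) x = 0 → (Δ (w t)) x ≤ 0 →
      wₜ t x ≤ 0)
    (hbot : ∀ x ∈ K, w T₁ x ≤ 0)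
    (hlat : ∀ t ∈ Icc T₁ T₂, ∀ x ∈ K \ U, w t x ≤ 0) :
    ∀ t ∈ Icc T₁ T₂, ∀ x ∈ K, w t x ≤ 0 := by
  by_contra H
  push Not at H
  obtain ⟨t₀, ht₀, x₀, hx₀, hpos⟩ := H
  set δ : ℝ := w t₀ x₀ with hδ
  set θ : ℝ := δ / (2 * (T₂ - T₁ + 1)) with hθ
  have hT : T₁ ≤ T₂ := ht₀.1.trans ht₀.2
  have hθpos : 0 < θ := div_pos hpos (by linarith)
  have hθδ : θ * (t₀ - T₁) < δ := by
    have h1 : θ * (t₀ - T₁) ≤ θ * (T₂ - T₁ + 1) :=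
      mul_le_mul_of_nonneg_left (by linarith [ht₀.2]) hθpos.le
    have h2 : θ * (T₂ - T₁ + 1) = δ / 2 := by
      rw [hθ, div_mul_eq_mul_div, mul_div_mul_right _ _ (by linarith : (T₂ - T₁ + 1) ≠ 0)]
    linarith
  set S : Set (ℝ × E) := Icc T₁ T₂ ×ˢ K with hS
  have hSc : IsCompact S := isCompact_Icc.prod hK
  set g : ℝ × E → ℝ := fun p => w p.1 p.2 - θ * (p.1 - T₁) with hg
  have hgc : ContinuousOn g S := by
    have h3 : Continuous fun p : ℝ × E => θ * (p.1 - T₁) := by fun_prop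
    exact hc.sub h3.continuousOn
  obtain ⟨⟨t', x'⟩, ⟨ht', hx'⟩, hmax⟩ := hSc.exists_isMaxOn ⟨(t₀, x₀), ht₀, hx₀⟩ hgc
  simp only at ht' hx'
  have hmax' : ∀ t ∈ Icc T₁ T₂, ∀ x ∈ K, w t x - θ * (t - T₁) ≤ w t' x' - θ * (t' - T₁) :=
    fun t ht x hx => hmax (show (t, x) ∈ S from ⟨ht, hx⟩)
  have hgpos : 0 < w t' x' - θ * (t' - T₁) := by
    have := hmax' t₀ ht₀ x₀ hx₀
    linarith
  have hwpos : 0 < w t' x' := by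
    have : 0 ≤ θ * (t' - T₁) := mul_nonneg hθpos.le (by linarith [ht'.1])
    linarith
  have ht'1 : T₁ < t' := by
    rcases eq_or_lt_of_le ht'.1 with h | h
    · exfalso
      have hb := hbot x' hx'
      rw [h] at hb
      linarith
    · exact h
  have hx'U : x' ∈ U := by
    by_contra hxU
    have hl := hlat t' ht' x' ⟨hx', hxU⟩
    linarith
  have ht'I : t' ∈ Ioc T₁ T₂ := ⟨ht'1, ht'.2⟩
  have hloc : IsLocalMax (w t') x' := by
    filter_upwards [hU.mem_nhds hx'U] with x hx
    have := hmax' t' ht' x (hUK hx)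
    linarith
  have hgrad : fderiv ℝ (w t') x' = 0 := hloc.fderiv_eq_zero
  have hlap : (Δ (w t')) x' ≤ 0 :=
    Literature.Analysis.PDE.LoewnerNirenberg.laplacian_nonpos_of_isLocalMax hloc (h2 t' ht'I x' hx'U)
  have hwt : wₜ t' x' ≤ 0 := hsub t' ht'I x' hx'U hwpos hgrad hlap
  have hderiv : HasDerivWithinAt (fun s => w s x' - θ * (s - T₁)) (wₜ t' x' - θ) (Icc T₁ t') t' := by
    have h1 := ht t' ht'I x' hx'U
    have h2 : HasDerivWithinAt (fun s : ℝ => θ * (s - T₁)) θ (Icc T₁ t') t' := by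
      have := ((hasDerivAt_id t').sub_const T₁).const_mul θ
      simpa using this.hasDerivWithinAt
    exact h1.sub h2
  have hmaxOn : IsLocalMaxOn (fun s => w s x' - θ * (s - T₁)) (Icc T₁ t') t' :=
    Filter.eventually_of_mem self_mem_nhdsWithin fun s hs =>
      hmax' s ⟨hs.1, hs.2.trans ht'.2⟩ x' hx'
  have hcone : T₁ - t' ∈ posTangentConeAt (Icc T₁ t') t' := by
    have hseg : segment ℝ t' T₁ ⊆ Icc T₁ t' := by
      rw [segment_symm, segment_eq_Icc ht'1.le]
    exact sub_mem_posTangentConeAt_of_segment_subset hseg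
  have key : (T₁ - t') * (wₜ t' x' - θ) ≤ 0 := by
    simpa using hmaxOn.hasFDerivWithinAt_nonpos hderiv.hasFDerivWithinAt hcone
  have hneg : T₁ - t' < 0 := by linarith
  have : 0 ≤ wₜ t' x' - θ := by
    by_contra hcon
    push Not at hcon
    have := mul_pos_of_neg_of_neg hneg hcon
    linarith
  linarith

end WeakMax


end Literature.Analysis.FluidPDE

end
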